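import Summits.AtomisticToContinuum.Crystallization.Theorems.FrustratedLawDichotomyCertFloorTailsHost

/-!
# FrustratedLawDichotomy · crux `AperiodicFrustratedLawGap` (stmt-AtomisticToContinuum-27623) — TRUNCATION TAILS FOR THE CLASS-A CERTIFICATE FLOOR, V:
# THE HOST FORCE TERM BY SITE POINT-GROUP SYMMETRY (non-Bravais hosts: hcp `D3h`, dhcp `D3h`/`D3d`; decomp-a2c hand-1 g52, companion of `…CertFloorTailsHost`)

Part IV (`…CertFloorTailsHost`) books the host column `Σ_{x∈I}⟪y_x, H_x⟫` of `certFloor` without force evaluations for templates closed under the MIRROR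
`x' ↦ 2x − x'` (Bravais hosts).  hcp and the stacking hosts are not Bravais, but every site `x` has a finite SITE POINT GROUP `G_x` of linear isometries
(acting on bond vectors `x' − x`) with trivial joint fixed space — hcp: `D3h ∋ C₃, σ_h`; dhcp: `D3h` at the hexagonal sites, `D3d ∋ −1` at the cubic ones —
under which the infinite host is invariant; NODE-11 `…WindowSymmetry.sum_radial_smul_eq_zero_of_isometries` then kills the force of every `G_x`-closed bond set.
This file is Part IV with the mirror replaced by such a family `A : ι → E3 →ₗᵢ[ℝ] E3` (closed under composition, trivial joint fixed space):

* ★ `norm_hostForce_le_of_orbit` — if every `x' ∈ a` with `dist x' x < ρ` has its whole orbit `x + A i (x' − x)` in `a` (`ρ ≥ δ/2`, `a` `δ`-separated),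
  then `‖H_x‖ ≤ T0_δ(ρ)`;
* `orbit_of_window` — a template ORBIT-CLOSED INSIDE ITS WINDOW of radius `R_w` (`x, x' ∈ a`, `‖x + A i (x' − x)‖ ≤ R_w ⇒ x + A i (x' − x) ∈ a`) is orbit-closed
  within `R_w − ‖x‖` at each site;
* ★★ `hostColumn_abs_le_of_window_orbit` — `|Σ_{x∈I}⟪y_x, H_x⟫| ≤ Σ_{x∈I}‖y_x‖·T0_δ(R_w − ‖x‖)` for such templates (`‖x‖ + δ/2 ≤ R_w` on `I`).
The family may depend on the site (apply the theorems site by site with `A := A_x`; the column version takes a site-indexed family).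
DEF-FREE; imports TREE `…CertFloorTailsHost`; 0 sorry.  All `[folklore]`.
-/

noncomputable section

namespace Summit.AtomisticToContinuum.Crystallization.Theorems.FrustratedLawDichotomyCertFloorTailsHostGroup

open Metric Set RealInnerProductSpace
open scoped BigOperators
open Summit.AtomisticToContinuum.Crystallization.Theorems.ChargedEnergyGapNegative (E3)
open Summit.AtomisticToContinuum.Crystallization.Theorems.FrustratedLawDichotomyCoherentFloorAlgebra
open Summit.AtomisticToContinuum.Crystallization.Theorems.FrustratedLawDichotomyWindowSymmetry (sum_radial_smul_eq_zero_of_isometries)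
open Summit.AtomisticToContinuum.Crystallization.Theorems.FrustratedLawDichotomyCertFloorTails (sum_psiTail_le)
open Summit.AtomisticToContinuum.Crystallization.Theorems.FrustratedLawDichotomyCertFloorTailsHost (norm_ljBondForce_le)

variable {ι : Type*}

/-- The bonds at `x` to an ORBIT-CLOSED set of template sites carry no force (NODE-11, point-group form). [folklore] -/
theorem sum_ljBondForce_eq_zero_of_orbit_closed (a : Finset E3) (x : E3) (A : ι → E3 →ₗᵢ[ℝ] E3)
    (hmul : ∀ i j, ∃ k, ∀ v, A k v = A i (A j v)) (hfix : ∀ v : E3, (∀ i, A i v = v) → v = 0)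
    (M : Finset E3) (hMa : M ⊆ a.erase x) (hM : ∀ x' ∈ M, ∀ i, x + A i (x' - x) ∈ a)
    (hMmax : ∀ x' ∈ a.erase x, (∀ i, x + A i (x' - x) ∈ a) → x' ∈ M) :
    ∑ x' ∈ M, ljBondForce (x - x') = 0 := by
  classical
  -- pass to bond vectors `w = x' − x` (the force is odd)
  have e : ∀ x', ljBondForce (x - x') = -ljBondForce (x' - x) := fun x' => by rw [← neg_sub, ljBondForce_neg]
  rw [Finset.sum_congr rfl fun x' _ => e x', Finset.sum_neg_distrib, neg_eq_zero]
  have hinj : Set.InjOn (fun x' : E3 => x' - x) (M : Set E3) := fun u _ v _ h => sub_left_injective h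
  rw [← Finset.sum_image hinj (f := fun w => ljBondForce w)]
  -- the bond set is permuted by every `A i`
  have hA : ∀ i, ∀ w ∈ M.image (fun x' => x' - x), A i w ∈ M.image (fun x' => x' - x) := by
    intro i w hw
    obtain ⟨x', hx', rfl⟩ := Finset.mem_image.mp hw
    have hx'a : x + A i (x' - x) ∈ a := hM x' hx' i
    have hne : x + A i (x' - x) ≠ x := by
      intro h
      have h1 : A i (x' - x) = 0 := by
        have := congrArg (fun z => z - x) h
        simpa using this
      have h2 : x' - x = 0 := by
        have := (A i).norm_map (x' - x)
        rw [h1, norm_zero] at this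
        exact norm_eq_zero.mp this.symm
      exact (Finset.mem_erase.mp (hMa hx')).1 (sub_eq_zero.mp h2)
    have hmem : x + A i (x' - x) ∈ M := by
      refine hMmax _ (Finset.mem_erase.mpr ⟨hne, hx'a⟩) fun j => ?_
      obtain ⟨k, hk⟩ := hmul j i
      have : x + A j (x + A i (x' - x) - x) = x + A k (x' - x) := by rw [add_sub_cancel_left, hk]
      rw [this]
      exact hM x' hx' k
    exact Finset.mem_image.mpr ⟨x + A i (x' - x), hmem, by rw [add_sub_cancel_left]⟩
  exact sum_radial_smul_eq_zero_of_isometries (M.image (fun x' => x' - x)) A psiT hA hfix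

/-- ★ If every template site within `ρ` of `x` has its whole `A`-orbit `x + A i (x' − x)` in the template (`A` closed under composition, trivial joint
fixed space; `ρ ≥ δ/2`, template `δ`-separated), then the window force at `x` is at most `T0_δ(ρ)`. [folklore] -/
theorem norm_hostForce_le_of_orbit (a : Finset E3) (x : E3) (A : ι → E3 →ₗᵢ[ℝ] E3)
    (hmul : ∀ i j, ∃ k, ∀ v, A k v = A i (A j v)) (hfix : ∀ v : E3, (∀ i, A i v = v) → v = 0)
    {δ ρ : ℝ} (hδ : 0 < δ) (hρ : δ / 2 ≤ ρ) (hsep : ∀ z ∈ a, ∀ z' ∈ a, z ≠ z' → δ ≤ dist z z')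
    (horb : ∀ x' ∈ a, x' ≠ x → dist x' x < ρ → ∀ i, x + A i (x' - x) ∈ a) :
    ‖∑ x' ∈ a.erase x, ljBondForce (x - x')‖
      ≤ (3 / 4 * (2 / δ) ^ 3 * ρ⁻¹ ^ 4 + 36 / 5 * (2 / δ) ^ 2 * ρ⁻¹ ^ 5 + 1 / 2 * (2 / δ) * ρ⁻¹ ^ 6 + 2 * ρ⁻¹ ^ 7)
        + (3 / 10 * (2 / δ) ^ 3 * ρ⁻¹ ^ 10 + 72 / 11 * (2 / δ) ^ 2 * ρ⁻¹ ^ 11 + 1 / 4 * (2 / δ) * ρ⁻¹ ^ 12 + 2 * ρ⁻¹ ^ 13) := by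
  classical
  set M := (a.erase x).filter (fun x' => ∀ i, x + A i (x' - x) ∈ a) with hMdef
  set R := (a.erase x).filter (fun x' => ¬ ∀ i, x + A i (x' - x) ∈ a) with hRdef
  rw [← Finset.sum_filter_add_sum_filter_not (a.erase x) (fun x' => ∀ i, x + A i (x' - x) ∈ a)]
  have h0 : ∑ x' ∈ M, ljBondForce (x - x') = 0 :=
    sum_ljBondForce_eq_zero_of_orbit_closed a x A hmul hfix M (Finset.filter_subset _ _)
      (fun x' hx' => (Finset.mem_filter.mp hx').2) (fun x' hx' h => Finset.mem_filter.mpr ⟨hx', h⟩)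
  rw [h0, zero_add]
  have hfar : ∀ x' ∈ R, ρ ≤ dist x' x := by
    intro x' hx'
    obtain ⟨hx'e, hx'm⟩ := Finset.mem_filter.mp hx'
    obtain ⟨hx'x, hx'a⟩ := Finset.mem_erase.mp hx'e
    by_contra h
    exact hx'm (horb x' hx'a hx'x (not_le.mp h))
  have hsepR : ∀ u ∈ R, ∀ v ∈ R, u ≠ v → δ ≤ dist u v := fun u hu v hv huv =>
    hsep u (Finset.mem_of_mem_erase (Finset.mem_filter.mp hu).1) v (Finset.mem_of_mem_erase (Finset.mem_filter.mp hv).1) huv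
  calc ‖∑ x' ∈ R, ljBondForce (x - x')‖ ≤ ∑ x' ∈ R, ‖ljBondForce (x - x')‖ := norm_sum_le _ _
    _ ≤ ∑ x' ∈ R, ((dist x' x)⁻¹ ^ 7 + (dist x' x)⁻¹ ^ 13) := by
        refine Finset.sum_le_sum fun x' _ => ?_
        rw [dist_comm, dist_eq_norm]
        exact norm_ljBondForce_le (x - x')
    _ ≤ _ := sum_psiTail_le R x hδ hρ hsepR hfar

/-- Orbit closure INSIDE A WINDOW implies orbit closure within `R_w − ‖x‖` of each site. [folklore] -/
theorem orbit_of_window (a : Finset E3) (A : ι → E3 →ₗᵢ[ℝ] E3) {R_w : ℝ}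
    (hwin : ∀ x ∈ a, ∀ x' ∈ a, ∀ i, ‖x + A i (x' - x)‖ ≤ R_w → x + A i (x' - x) ∈ a)
    {x : E3} (hx : x ∈ a) : ∀ x' ∈ a, x' ≠ x → dist x' x < R_w - ‖x‖ → ∀ i, x + A i (x' - x) ∈ a := by
  intro x' hx'a _ hd i
  refine hwin x hx x' hx'a i ?_
  have h := norm_add_le x (A i (x' - x))
  rw [(A i).norm_map, ← dist_eq_norm] at h
  linarith

/-- ★★ **THE HOST COLUMN WITHOUT FORCE EVALUATIONS, point-group form.**  A site-indexed family `A x : ι → E3 →ₗᵢ E3` (each closed under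
composition with trivial joint fixed space — the site point group of the host at `x`), a `δ`-separated template ORBIT-CLOSED INSIDE ITS WINDOW of
radius `R_w`, interior `I ⊆ a` with `‖x‖ + δ/2 ≤ R_w`, any multipliers `y`:
`|Σ_{x∈I} ⟪y_x, Σ_{x'∈a∖x} ljBondForce (x − x')⟫| ≤ Σ_{x∈I} ‖y_x‖·T0_δ(R_w − ‖x‖)`. [folklore] -/
theorem hostColumn_abs_le_of_window_orbit (a I : Finset E3) (y : E3 → E3) (A : E3 → ι → E3 →ₗᵢ[ℝ] E3)
    (hmul : ∀ x i j, ∃ k, ∀ v, A x k v = A x i (A x j v)) (hfix : ∀ x, ∀ v : E3, (∀ i, A x i v = v) → v = 0)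
    {δ R_w : ℝ} (hδ : 0 < δ) (hsep : ∀ z ∈ a, ∀ z' ∈ a, z ≠ z' → δ ≤ dist z z') (hIa : I ⊆ a)
    (hwin : ∀ x ∈ a, ∀ x' ∈ a, ∀ i, ‖x + A x i (x' - x)‖ ≤ R_w → x + A x i (x' - x) ∈ a) (hI : ∀ x ∈ I, ‖x‖ + δ / 2 ≤ R_w) :
    |∑ x ∈ I, ⟪y x, ∑ x' ∈ a.erase x, ljBondForce (x - x')⟫|
      ≤ ∑ x ∈ I, ‖y x‖ *
        ((3 / 4 * (2 / δ) ^ 3 * (R_w - ‖x‖)⁻¹ ^ 4 + 36 / 5 * (2 / δ) ^ 2 * (R_w - ‖x‖)⁻¹ ^ 5 + 1 / 2 * (2 / δ) * (R_w - ‖x‖)⁻¹ ^ 6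
            + 2 * (R_w - ‖x‖)⁻¹ ^ 7)
          + (3 / 10 * (2 / δ) ^ 3 * (R_w - ‖x‖)⁻¹ ^ 10 + 72 / 11 * (2 / δ) ^ 2 * (R_w - ‖x‖)⁻¹ ^ 11 + 1 / 4 * (2 / δ) * (R_w - ‖x‖)⁻¹ ^ 12
            + 2 * (R_w - ‖x‖)⁻¹ ^ 13)) := by
  refine (Finset.abs_sum_le_sum_abs _ _).trans (Finset.sum_le_sum fun x hx => ?_)
  refine (abs_real_inner_le_norm _ _).trans (mul_le_mul_of_nonneg_left ?_ (norm_nonneg _))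
  refine norm_hostForce_le_of_orbit a x (A x) (hmul x) (hfix x) hδ (by linarith [hI x hx]) hsep ?_
  intro x' hx'a hx'x hd i
  refine hwin x (hIa hx) x' hx'a i ?_
  have h := norm_add_le x (A x i (x' - x))
  rw [(A x i).norm_map, ← dist_eq_norm] at h
  linarith

end Summit.AtomisticToContinuum.Crystallization.Theorems.FrustratedLawDichotomyCertFloorTailsHostGroup

end
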